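import Literature.NumberTheory.ModularForms.RademacherPhiCompositionProofs
import HarnessLib

/-!
# Weighted `Ψ`-combinations: the logarithmic period of an `η`-quotient is a homomorphism on `Γ₀(N)`

Topic `Literature/NumberTheory/ModularForms`; namespace `Literature.NumberTheory.ModularForms`.
Theorem-only sequel of `RademacherPhiCompositionProofs` (no definitions, no named facts, no
analysis).

For an exponent vector `r : ℕ → ℤ` on the divisors of `N` and `M = (a b; c d)` with `N ∣ c`, the
**logarithmic period** of the `η`-quotient `∏_{t ∣ N} η(tτ)^{r_t}` along `M` is (up to the factor
`1/24`) the weighted sum `L_r(M) = Σ_{t ∣ N} r_t Φ(a, tb; c/t, d)` of Rademacher's `Φ` at the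
conjugates `M_t = diag(t,1) M diag(t,1)⁻¹` [cite: RademacherGrosswald1972, Ch. 4 A, eq. (59)–(60)]
(cf. `EtaMultiplierRademacherPhi`: `e^{2πi L_r(M)/24}` is the multiplier of the quotient).  Since
`Φ(M_t) = Φ(M) − Ψ_t(M)` and `Ψ_t` is a HOMOMORPHISM on `Γ₀(t)` (`eisensteinPsiSL_mul'`, from the
composition law (62)), **`L_r` is a homomorphism `Γ₀(N) → ℚ` as soon as `Σ_t r_t = 0`** (weight `0`):

* `sum_rademacherPhi_conj_mul` — `L_r(AB) = L_r(A) + L_r(B)` for `A, B ∈ Γ₀(N)`;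
  `sum_rademacherPhi_conj_one`, `sum_rademacherPhi_conj_inv`;
* `sum_rademacherPhi_conj_leftMul` — the entrywise form for left multiplication by
  `(1 0; eN 1)`: `L_r(a, b; c + eNa, d + eNb) = L_r(1, 0; eN, 1) + L_r(a, b; c, d)`.

## References

* [RademacherGrosswald1972] H. Rademacher, E. Grosswald, *Dedekind Sums*, Carus Math. Monographs 16
  (1972), Ch. 4 A, eq. (59)–(62).
-/

open scoped MatrixGroups

namespace Literature.NumberTheory.ModularForms

/-- **The weighted log-period is additive on `Γ₀(N)`** (weight `0`): for `Σ_{t ∣ N} r_t = 0` and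
`A, B ∈ SL₂(ℤ)` with `N ∣ A₁₀`, `N ∣ B₁₀`,
`Σ_t r_t Φ((AB)_t) = Σ_t r_t Φ(A_t) + Σ_t r_t Φ(B_t)`, where `M_t = (M₀₀, t M₀₁; M₁₀/t, M₁₁)`.
(Each `Ψ_t = Φ − Φ(·_t)` is additive on `Γ₀(t) ⊇ Γ₀(N)`, and the `Φ`-terms cancel because
`Σ r_t = 0`.) [cite: RademacherGrosswald1972, Ch. 4 A, eq. (62)] -/
theorem sum_rademacherPhi_conj_mul (N : ℕ) (r : ℕ → ℤ) (h0 : ∑ t ∈ N.divisors, r t = 0)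
    {A B : SL(2, ℤ)} (hA : (N : ℤ) ∣ A 1 0) (hB : (N : ℤ) ∣ B 1 0) :
    ∑ t ∈ N.divisors, (r t : ℚ) *
        rademacherPhi ((A * B) 0 0) (t * (A * B) 0 1) ((A * B) 1 0 / t) ((A * B) 1 1) =
      ∑ t ∈ N.divisors, (r t : ℚ) * rademacherPhi (A 0 0) (t * A 0 1) (A 1 0 / t) (A 1 1) +
        ∑ t ∈ N.divisors, (r t : ℚ) * rademacherPhi (B 0 0) (t * B 0 1) (B 1 0 / t) (B 1 1) := by
  have key : ∀ t ∈ N.divisors, (r t : ℚ) *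
      rademacherPhi ((A * B) 0 0) (t * (A * B) 0 1) ((A * B) 1 0 / t) ((A * B) 1 1) =
        (r t : ℚ) * rademacherPhi (A 0 0) (t * A 0 1) (A 1 0 / t) (A 1 1) +
          (r t : ℚ) * rademacherPhi (B 0 0) (t * B 0 1) (B 1 0 / t) (B 1 1) +
          (r t : ℚ) * (rademacherPhiSL (A * B) - rademacherPhiSL A - rademacherPhiSL B) := by
    intro t ht
    have htN : (t : ℤ) ∣ N := Int.natCast_dvd_natCast.mpr (Nat.dvd_of_mem_divisors ht)
    have hΨ := eisensteinPsiSL_mul' (Nat.pos_of_mem_divisors ht) (dvd_trans htN hA)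
      (dvd_trans htN hB)
    rw [eisensteinPsiSL_apply, eisensteinPsiSL_apply, eisensteinPsiSL_apply] at hΨ
    linear_combination (-(r t : ℚ)) * hΨ
  rw [Finset.sum_congr rfl key, Finset.sum_add_distrib, Finset.sum_add_distrib, ← Finset.sum_mul,
    show (∑ t ∈ N.divisors, (r t : ℚ)) = 0 from by exact_mod_cast h0, zero_mul, add_zero]

/-- `L_r(1) = 0` (`Φ(1) = 0`). [cite: RademacherGrosswald1972, Ch. 4 A, eq. (59)] -/
theorem sum_rademacherPhi_conj_one (N : ℕ) (r : ℕ → ℤ) :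
    ∑ t ∈ N.divisors, (r t : ℚ) *
      rademacherPhi ((1 : SL(2, ℤ)) 0 0) (t * (1 : SL(2, ℤ)) 0 1) ((1 : SL(2, ℤ)) 1 0 / t)
        ((1 : SL(2, ℤ)) 1 1) = 0 :=
  Finset.sum_eq_zero fun t _ ↦ by simp [rademacherPhi_of_c_eq_zero]

/-- `L_r(A⁻¹) = −L_r(A)` on `Γ₀(N)` (weight `0`). [cite: RademacherGrosswald1972, Ch. 4 A, eq. (62)] -/
theorem sum_rademacherPhi_conj_inv (N : ℕ) (r : ℕ → ℤ) (h0 : ∑ t ∈ N.divisors, r t = 0)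
    {A : SL(2, ℤ)} (hA : (N : ℤ) ∣ A 1 0) :
    ∑ t ∈ N.divisors, (r t : ℚ) *
        rademacherPhi ((A⁻¹) 0 0) (t * (A⁻¹) 0 1) ((A⁻¹) 1 0 / t) ((A⁻¹) 1 1) =
      -∑ t ∈ N.divisors, (r t : ℚ) * rademacherPhi (A 0 0) (t * A 0 1) (A 1 0 / t) (A 1 1) := by
  have hAinv : (N : ℤ) ∣ (A⁻¹) 1 0 := by
    simp [Matrix.SpecialLinearGroup.coe_inv, Matrix.adjugate_fin_two]
    exact hA
  have h := sum_rademacherPhi_conj_mul N r h0 hAinv hA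
  rw [inv_mul_cancel, sum_rademacherPhi_conj_one] at h
  linarith

/-- **Entrywise form, left translation by `(1 0; eN 1)`**: for `Σ r_t = 0`, `ad − bc = 1`, `N ∣ c`
and any `e ∈ ℤ`,
`Σ_t r_t Φ(a, tb; (c + eNa)/t, d + eNb) = Σ_t r_t Φ(1, 0; eN/t, 1) + Σ_t r_t Φ(a, tb; c/t, d)`
(`(1 0; eN 1)(a b; c d) = (a, b; c + eNa, d + eNb)`). [cite: RademacherGrosswald1972, Ch. 4 A, eq. (62)] -/
theorem sum_rademacherPhi_conj_leftMul (N : ℕ) (r : ℕ → ℤ) (h0 : ∑ t ∈ N.divisors, r t = 0)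
    {a b c d : ℤ} (hdet : a * d - b * c = 1) (hNc : (N : ℤ) ∣ c) (e : ℤ) :
    ∑ t ∈ N.divisors, (r t : ℚ) * rademacherPhi a (t * b) ((c + e * N * a) / t) (d + e * N * b) =
      ∑ t ∈ N.divisors, (r t : ℚ) * rademacherPhi 1 (t * 0) ((e * N) / t) 1 +
        ∑ t ∈ N.divisors, (r t : ℚ) * rademacherPhi a (t * b) (c / t) d := by
  let A : SL(2, ℤ) := ⟨!![1, 0; e * N, 1], by rw [Matrix.det_fin_two_of]; ring⟩
  let B : SL(2, ℤ) := ⟨!![a, b; c, d], by rw [Matrix.det_fin_two_of]; linear_combination hdet⟩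
  have hA : (N : ℤ) ∣ A 1 0 := by simp [A]
  have hB : (N : ℤ) ∣ B 1 0 := by simpa [B] using hNc
  have h := sum_rademacherPhi_conj_mul N r h0 hA hB
  have hAB : ((A * B) 0 0 = a ∧ (A * B) 0 1 = b) ∧ (A * B) 1 0 = c + e * N * a ∧
      (A * B) 1 1 = d + e * N * b := by
    simp [A, B, Matrix.mul_apply, Fin.sum_univ_two]
    constructor <;> ring
  obtain ⟨⟨h00, h01⟩, h10, h11⟩ := hAB
  simpa [A, B, h00, h01, h10, h11] using h

end Literature.NumberTheory.ModularForms
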